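import Literature.AnabelianGeometry.SemiGraphs.CompactInVerticialAtCoveringGraphCorollaries
import Literature.AnabelianGeometry.SemiGraphs.CoveringGraphConnected
import Literature.AnabelianGeometry.SemiGraphs.TemperedReconstructionCor39UpToTwistAssemblyAt
import HarnessLib

/-!
# [SemiAnbd] Thm 3.7 (iii)/(iv) AT covering semi-graphs of anabelioids — final form

Mochizuki, *Semi-graphs of anabelioids*, Publ. RIMS **42** (2006), §3, Theorem 3.7 (iii)/(iv) pp. 40–41
[cite: MochizukiSemiAnbd2006, Thm 3.7(iii)(iv) pp.40-41].  The transfer theorems of route T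
(`CovObj.compactInVerticialAt_coveringGraph` and its corollaries) with the hypothesis "`S` is a
connected object" DISCHARGED from the antecedent `Thm37Hypotheses G_S` of the transferred per-graph
statements (`CovObj.isConnectedObj_of_thm37Hypotheses_coveringGraph`): for every tempered `S` over a
coherent `G` as in Theorem 3.7,
* `CompactInVerticialAt G → CompactInVerticialAt G_S` and the (iv) / edge-like twins;
* for `G` FINITE these hold outright (`compactInVerticialAt_of_finiteGraph`);
* hence [SemiAnbd] Corollary 3.9 (compatible reading, up to twist; abc-iut-w4-d080's per-pair closer
  `cor39UpToTwistAt`, which needs only Thm. 3.7 (iii) AT the two graphs) between the covering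
  semi-graphs of anabelioids of tempered coverings of FINITE coherent Thm-3.7 graphs
  (`cor39UpToTwistAt_coveringGraph_of_finite`).
Proof-only (abc-iut cell, L3 route T, brick T6; L3-lead ruling α42 (3)); nothing here asserts Thm 3.7
(iii) for an arbitrary infinite `G`, and nothing bears on [IUTchIII] Cor. 3.12.
-/

open CategoryTheory

namespace Literature.AnabelianGeometry.SemiGraphs

namespace ProfiniteSemiGraph

namespace CovObj

universe u

variable {𝒢 : ProfiniteSemiGraph.{u}} (S : CovObj 𝒢)

/-- **Thm 3.7 (iii) transfers along tempered coverings** (no connectedness hypothesis: it is part of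
the antecedent `Thm37Hypotheses G_S`). [cite: MochizukiSemiAnbd2006, Thm 3.7(iii) pp.40-41] -/
theorem compactInVerticialAt_coveringGraph' (h𝒢 : 𝒢.Thm37Hypotheses) (hcoh : 𝒢.IsCoherent)
    (hiii : CompactInVerticialAt 𝒢) (hS : S.IsTempered) : CompactInVerticialAt S.coveringGraph :=
  fun h => S.compactInVerticialAt_coveringGraph h𝒢 hcoh hiii hS
    (S.isConnectedObj_of_thm37Hypotheses_coveringGraph hS h) h

/-- **Thm 3.7 (iv) transfers along tempered coverings** (no connectedness hypothesis).
[cite: MochizukiSemiAnbd2006, Thm 3.7(iv) p.41] -/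
theorem maximalCompactIffVerticialAt_coveringGraph' (h𝒢 : 𝒢.Thm37Hypotheses) (hcoh : 𝒢.IsCoherent)
    (hiii : CompactInVerticialAt 𝒢) (hS : S.IsTempered) : MaximalCompactIffVerticialAt S.coveringGraph :=
  fun h => S.maximalCompactIffVerticialAt_coveringGraph h𝒢 hcoh hiii hS
    (S.isConnectedObj_of_thm37Hypotheses_coveringGraph hS h) h

/-- The edge-like corollaries transfer (no connectedness hypothesis). [cite: MochizukiSemiAnbd2006, Thm 3.7(iv) p.41] -/
theorem edgeLikeAt_coveringGraph' (h𝒢 : 𝒢.Thm37Hypotheses) (hcoh : 𝒢.IsCoherent)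
    (hiii : CompactInVerticialAt 𝒢) (hS : S.IsTempered) :
    EdgeLikeIsInfVerticialAt S.coveringGraph ∧ EdgeLikeDistinctAt S.coveringGraph :=
  ⟨fun h => S.edgeLikeIsInfVerticialAt_coveringGraph h𝒢 hcoh hiii hS
      (S.isConnectedObj_of_thm37Hypotheses_coveringGraph hS h) h,
    fun h => S.edgeLikeDistinctAt_coveringGraph h𝒢 hcoh hiii hS
      (S.isConnectedObj_of_thm37Hypotheses_coveringGraph hS h) h⟩

/-- **Thm 3.7 (iii) AT the covering semi-graph of anabelioids of EVERY tempered covering of a FINITE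
coherent Thm-3.7 graph of anabelioids** (covering graphs in general infinite: universal graph-coverings,
infinite cyclic coverings). [cite: MochizukiSemiAnbd2006, Thm 3.7(iii) pp.40-41] -/
theorem compactInVerticialAt_coveringGraph_of_finite' [Finite 𝒢.graph.Vertex] [Finite 𝒢.graph.Edge]
    (h𝒢 : 𝒢.Thm37Hypotheses) (hcoh : 𝒢.IsCoherent) (hS : S.IsTempered) :
    CompactInVerticialAt S.coveringGraph :=
  S.compactInVerticialAt_coveringGraph' h𝒢 hcoh compactInVerticialAt_of_finiteGraph hS

/-- **Thm 3.7 (iv) AT the covering semi-graph of anabelioids of EVERY tempered covering of a FINITE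
coherent Thm-3.7 graph of anabelioids.** [cite: MochizukiSemiAnbd2006, Thm 3.7(iv) p.41] -/
theorem maximalCompactIffVerticialAt_coveringGraph_of_finite' [Finite 𝒢.graph.Vertex]
    [Finite 𝒢.graph.Edge] (h𝒢 : 𝒢.Thm37Hypotheses) (hcoh : 𝒢.IsCoherent) (hS : S.IsTempered) :
    MaximalCompactIffVerticialAt S.coveringGraph :=
  S.maximalCompactIffVerticialAt_coveringGraph' h𝒢 hcoh compactInVerticialAt_of_finiteGraph hS

/-- The edge-like corollaries at such covering graphs. [cite: MochizukiSemiAnbd2006, Thm 3.7(iv) p.41] -/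
theorem edgeLikeAt_coveringGraph_of_finite' [Finite 𝒢.graph.Vertex] [Finite 𝒢.graph.Edge]
    (h𝒢 : 𝒢.Thm37Hypotheses) (hcoh : 𝒢.IsCoherent) (hS : S.IsTempered) :
    EdgeLikeIsInfVerticialAt S.coveringGraph ∧ EdgeLikeDistinctAt S.coveringGraph :=
  S.edgeLikeAt_coveringGraph' h𝒢 hcoh compactInVerticialAt_of_finiteGraph hS

/-- **[SemiAnbd] Corollary 3.9 (compatible reading, "induced" up to twist) between the covering
semi-graphs of anabelioids `G_S`, `H_T` of tempered coverings `S`, `T` of FINITE coherent Thm-3.7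
graphs `G`, `H`** (given the hypotheses of Cor. 3.9 for `G_S`, `H_T`): abc-iut-w4-d080's per-pair
closer `cor39UpToTwistAt`, whose only Thm-3.7 inputs — (iii) AT `G_S` and AT `H_T` — are now theorems.
[cite: MochizukiSemiAnbd2006, Cor 3.9 pp.42-43] -/
theorem cor39UpToTwistAt_coveringGraph_of_finite {ℋ : ProfiniteSemiGraph.{u}}
    [Finite 𝒢.graph.Vertex] [Finite 𝒢.graph.Edge] [Finite ℋ.graph.Vertex] [Finite ℋ.graph.Edge]
    (h𝒢 : 𝒢.Thm37Hypotheses) (hcoh : 𝒢.IsCoherent) (hℋ : ℋ.Thm37Hypotheses) (hcohℋ : ℋ.IsCoherent)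
    (hS : S.IsTempered) (T : CovObj ℋ) (hT : T.IsTempered)
    (h39S : Cor39Hypotheses S.coveringGraph) (h39T : Cor39Hypotheses T.coveringGraph)
    (cS : TemperedPiChart S.coveringGraph) (cT : TemperedPiChart T.coveringGraph) :
    (∀ (F : ProfiniteSemiGraph.Hom S.coveringGraph T.coveringGraph), F.IsLocallyOpen →
        ∀ φ : cS.G →ₜ* cT.G,
          (∃ θ : F.ConjugatorFamily, Nonempty (F.chartPullbackWith θ cS cT ≅ BTemp.res φ)) →
            IsCompatiblyQuasiGeometric φ) ∧
      ∀ φ : cS.G →ₜ* cT.G, IsCompatiblyQuasiGeometric φ →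
        ∃ F : ProfiniteSemiGraph.Hom S.coveringGraph T.coveringGraph, F.IsLocallyOpen ∧
          (∃ θ : F.ConjugatorFamily, Nonempty (F.chartPullbackWith θ cS cT ≅ BTemp.res φ)) ∧
          ∀ F' : ProfiniteSemiGraph.Hom S.coveringGraph T.coveringGraph, F'.IsLocallyOpen →
            (∃ θ' : F'.ConjugatorFamily, Nonempty (F'.chartPullbackWith θ' cS cT ≅ BTemp.res φ)) →
              F'.base.vertexMap = F.base.vertexMap ∧ F'.base.edgeMap = F.base.edgeMap :=
  cor39UpToTwistAt (S.compactInVerticialAt_coveringGraph_of_finite' h𝒢 hcoh hS)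
    (T.compactInVerticialAt_coveringGraph_of_finite' hℋ hcohℋ hT) h39S h39T cS cT

end CovObj

end ProfiniteSemiGraph

end Literature.AnabelianGeometry.SemiGraphs
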